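import Literature.Algebra.Module.DedekindLatticeIsoClasses
import Mathlib.NumberTheory.NumberField.ClassNumber
import Mathlib.NumberTheory.Padics.RingHoms
import Mathlib.LinearAlgebra.Matrix.ToLin
import Mathlib.Algebra.Module.Submodule.Pointwise
import HarnessLib

/-!
# Lattices stable under an order of a CM ring, rank `r`: the class / shape pigeonhole

Pure commutative algebra behind the finiteness of isomorphism classes in an `ℓ`-power isogeny
tower of a POWER (or same-field product) of CM abelian varieties (topic
`NumberTheory/ComplexMultiplication`; theorems only, no definition, no named fact).  Rank-`r`
twin of `CMLatticeIdealClassPigeonhole` (rank one).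

SETTING.  `K` is a number field, `𝓞 = 𝓞 K`, `ℓ` a prime, `T` a `ℤ_ℓ`-module with a ring action
`ι : 𝓞 → End_{ℤ_ℓ}(T)` which is FREE OF RANK `r` OVER `ℤ_ℓ ⊗ 𝓞` in the concrete sense: there
are `t_i ∈ T` (`i : Fin r`), an integral basis `(b_k)` of `𝓞` and a `ℤ_ℓ`-basis `(B_{i,k})` of
`T` with `B_{i,k} = ι(b_k) t_i`; and a MATRIX ACTION `ιM : M_r(𝓞) → End_{ℤ_ℓ}(T)` (a ring
homomorphism) with `ιM(e) t_i = Σ_j ι(e_{ji}) t_j` and `ιM(a • 1) = ι(a)`.  (For `P = A₀ʳ` with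
`(A₀, ι₀)` a CM abelian variety: `T = T_ℓ P`, `ιM = T_ℓ ∘ (matrix endomorphisms)`.)

THE THEOREM (`exists_infinite_forall_exists_matrix_pow_smul_map_eq`).  Let `N : ℕ` and let
`X : ℕ → {ℤ_ℓ-submodules of T}` be any sequence of LATTICES (`ℓ^{j_i} T ⊆ X i`) that are
stable under the order `ℤ_ℓ + ℓᴺ(ℤ_ℓ ⊗ 𝓞)` (`ℓᴺ ι(a) (X i) ⊆ X i`).  Then on an infinite set
`S` of indices any two lattices are related by a global `ℓ`-unit of `M_r(𝓞)`: for `m, n ∈ S`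
there are matrices `e, e' ∈ M_r(𝓞)` with `e e' = e' e = ℓᵈ` and `ℓᶜ · ιM(e)(X m) = ℓᵃ · X n`.

THE ARGUMENT.  As in rank one, `X̂ = Σ_a ι(a) X` satisfies `ℓᴺ X̂ ⊆ X ⊆ X̂` and corresponds to
the GLOBAL `𝓞`-lattice `M_X = {v ∈ 𝓞ʳ : Σ_i ι(v_i) t_i ∈ X̂} ⊇ ℓ^{j} 𝓞ʳ` (the `ℓ`-adic
coordinates of an element of `T` are integers modulo `ℓ^j T ⊆ X̂`).  (1) CLASS: by
`DedekindLattice.exists_classMap_nonempty_linearEquiv` (Steinitz's splitting, `Cl(𝓞)` finite)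
the `M_{X i}` fall into finitely many isomorphism classes; an isomorphism of two of them is
realised by integral matrices `e, e'` with `e e' = e' e = ℓ^{j+j'}`, `e M' = ℓ^{j'} M`
(`DedekindLattice.exists_end_comp_eq_smul_of_linearEquiv`), hence `ιM(e) X̂' = ℓ^{j'} X̂`.
(2) SHAPE: `ιM(e_i) X_i = ℓ^{a_i} Z_i` with `ℓ^{N+j₀} T ⊆ Z_i ⊆ T`, finitely many `Z`; equal
shapes give `ℓ^{j n} ιM(e'_n e_m) X_m = ℓ^{j m + d_n} X_n`.

## References

* [Tate1966Endomorphisms] J. Tate, Invent. Math. 2 (1966), §2, pp. 136–137.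
* [Shimura1998] G. Shimura, *Abelian Varieties with Complex Multiplication and Modular Functions*
  (1998), §7.4 Propositions 15 and 17.
* [Reiner2003MaximalOrders] I. Reiner, *Maximal Orders*, §4 (Steinitz), §26 (Jordan–Zassenhaus).
-/

noncomputable section

open scoped NumberField Pointwise nonZeroDivisors

namespace Literature.NumberTheory.ComplexMultiplication

open Literature.Algebra.Module

section CMLatticeRank

variable {K : Type*} [Field K] [NumberField K] {ℓ : ℕ} [Fact ℓ.Prime]
  {T : Type*} [AddCommGroup T] [Module ℤ_[ℓ] T]
  (ι : 𝓞 K →+* Module.End ℤ_[ℓ] T) {r : ℕ} (t : Fin r → T)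
  {κ : Type*} [Fintype κ] (b : Module.Basis κ ℤ (𝓞 K)) (B : Module.Basis (Fin r × κ) ℤ_[ℓ] T)

/-! ## §1 `ℓ`-adic coordinates: integers modulo `ℓᴹ` -/

omit [NumberField K] in
/-- `Σ_i ι(Σ_k n_{ik} b_k) t_i = Σ_{(i,k)} n_{ik} B_{ik}` in the basis `B_{ik} = ι(b_k) t_i`. [folklore] -/
private theorem sum_apply_sum_natCast_mul (hB : ∀ i k, B (i, k) = ι (b k) (t i))
    (n : Fin r × κ → ℕ) :
    ∑ i, ι (∑ k, (n (i, k) : 𝓞 K) * b k) (t i) = ∑ p, ((n p : ℕ) : ℤ_[ℓ]) • B p := by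
  rw [Fintype.sum_prod_type]
  refine Finset.sum_congr rfl fun i _ => ?_
  rw [map_sum, LinearMap.sum_apply]
  refine Finset.sum_congr rfl fun k _ => ?_
  rw [map_mul, map_natCast, Module.End.mul_apply, Module.End.natCast_apply, ← hB,
    Nat.cast_smul_eq_nsmul]

omit [NumberField K] in
/-- `ι(ℓⁿ)` acts as multiplication by `ℓⁿ ∈ ℤ_ℓ`. [folklore] -/
private theorem apply_natCast_pow (n : ℕ) (z : T) : ι ((ℓ : 𝓞 K) ^ n) z = (ℓ : ℤ_[ℓ]) ^ n • z := by
  rw [map_pow, map_natCast]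
  induction n with
  | zero => rw [pow_zero, pow_zero, one_smul, Module.End.one_apply]
  | succ n ih =>
    rw [pow_succ', Module.End.mul_apply, ih, Module.End.natCast_apply,
      ← Nat.cast_smul_eq_nsmul ℤ_[ℓ], ← mul_smul, ← pow_succ']

omit [NumberField K] in
/-- Every `y ∈ T` is congruent modulo `ℓᴹ T` to an element with natural-number coordinates
(`ℤ` is dense in `ℤ_ℓ`: `PadicInt.appr`). [folklore] -/
private theorem exists_natCoords (M : ℕ) (y : T) :
    ∃ n : Fin r × κ → ℕ, (∀ p, n p < ℓ ^ M) ∧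
      ∃ y' : T, y = ∑ p, ((n p : ℕ) : ℤ_[ℓ]) • B p + (ℓ : ℤ_[ℓ]) ^ M • y' := by
  classical
  refine ⟨fun p => (B.repr y p).appr M, fun p => PadicInt.appr_lt _ _, ?_⟩
  have hd : ∀ p, ∃ d : ℤ_[ℓ], d * (ℓ : ℤ_[ℓ]) ^ M = B.repr y p - ((B.repr y p).appr M : ℕ) :=
    fun p => Ideal.mem_span_singleton'.mp (PadicInt.appr_spec M (B.repr y p))
  choose d hd using hd
  refine ⟨∑ p, d p • B p, ?_⟩
  conv_lhs => rw [← B.sum_repr y]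
  rw [Finset.smul_sum, ← Finset.sum_add_distrib]
  refine Finset.sum_congr rfl fun p _ => ?_
  rw [← mul_smul, mul_comm, hd p, ← add_smul, add_sub_cancel]

omit [NumberField K] in
include B in
/-- **Finitely many lattices between `ℓᴹ T` and `T`** (`T / ℓᴹ T` is finite). [folklore] -/
private theorem finite_setOf_pow_smul_top_le (M : ℕ) :
    {Z : Submodule ℤ_[ℓ] T | (ℓ : ℤ_[ℓ]) ^ M • (⊤ : Submodule ℤ_[ℓ] T) ≤ Z}.Finite := by
  classical
  let box : Set (Fin r × κ → ℕ) := Set.univ.pi fun _ => Set.Iio (ℓ ^ M)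
  have hbox : box.Finite := Set.Finite.pi fun _ => Set.finite_Iio _
  let code : Submodule ℤ_[ℓ] T → Set (Fin r × κ → ℕ) := fun Z =>
    {n | n ∈ box ∧ ∑ p, ((n p : ℕ) : ℤ_[ℓ]) • B p ∈ Z}
  refine Set.Finite.of_finite_image (f := code) ((hbox.finite_subsets).subset ?_) ?_
  · rintro _ ⟨Z, -, rfl⟩
    exact fun n hn => hn.1
  · intro Z hZ Z' hZ' hZZ'
    simp only [Set.mem_setOf_eq] at hZ hZ'
    suffices key : ∀ {Z Z' : Submodule ℤ_[ℓ] T}, (ℓ : ℤ_[ℓ]) ^ M • (⊤ : Submodule ℤ_[ℓ] T) ≤ Z →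
        (ℓ : ℤ_[ℓ]) ^ M • (⊤ : Submodule ℤ_[ℓ] T) ≤ Z' → code Z = code Z' → Z ≤ Z' from
      le_antisymm (key hZ hZ' hZZ') (key hZ' hZ hZZ'.symm)
    intro Z Z' hZ hZ' h y hy
    obtain ⟨n, hn, y', hyy'⟩ := exists_natCoords B M y
    have hmem : (ℓ : ℤ_[ℓ]) ^ M • y' ∈ Z := hZ (Submodule.smul_mem_pointwise_smul _ _ _ trivial)
    have hmem' : (ℓ : ℤ_[ℓ]) ^ M • y' ∈ Z' := hZ' (Submodule.smul_mem_pointwise_smul _ _ _ trivial)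
    have hsum : ∑ p, ((n p : ℕ) : ℤ_[ℓ]) • B p ∈ Z := by
      have : ∑ p, ((n p : ℕ) : ℤ_[ℓ]) • B p = y - (ℓ : ℤ_[ℓ]) ^ M • y' := by
        rw [hyy', add_sub_cancel_right]
      rw [this]
      exact Z.sub_mem hy hmem
    have hn' : n ∈ code Z := ⟨fun p _ => hn p, hsum⟩
    rw [h] at hn'
    rw [hyy']
    exact Z'.add_mem hn'.2 hmem'

/-! ## §2 The lattice `⟨Σ_i ι(v_i) t_i : v ∈ M⟩` of an `𝓞`-submodule `M ⊆ 𝓞ʳ` -/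

omit [NumberField K] in
/-- `Ψ(v) = Σ_i ι(v_i) t_i` is additive. [folklore] -/
private theorem psi_add (v w : Fin r → 𝓞 K) :
    ∑ i, ι ((v + w) i) (t i) = ∑ i, ι (v i) (t i) + ∑ i, ι (w i) (t i) := by
  rw [← Finset.sum_add_distrib]
  exact Finset.sum_congr rfl fun i _ => by rw [Pi.add_apply, map_add, LinearMap.add_apply]

omit [NumberField K] in
/-- `Ψ(a • v) = ι(a) Ψ(v)`. [folklore] -/
private theorem psi_smul (a : 𝓞 K) (v : Fin r → 𝓞 K) :
    ∑ i, ι ((a • v) i) (t i) = ι a (∑ i, ι (v i) (t i)) := by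
  rw [map_sum]
  exact Finset.sum_congr rfl fun i _ => by
    rw [Pi.smul_apply, smul_eq_mul, map_mul, Module.End.mul_apply]

omit [NumberField K] in
/-- `Ψ(e v) = ιM(e) Ψ(v)` for the matrix action. [folklore] -/
private theorem psi_mulVec (ιM : Matrix (Fin r) (Fin r) (𝓞 K) →+* Module.End ℤ_[ℓ] T)
    (hMt : ∀ e i, ιM e (t i) = ∑ j, ι (e j i) (t j)) (hMs : ∀ a : 𝓞 K, ιM (a • 1) = ι a)
    (e : Matrix (Fin r) (Fin r) (𝓞 K)) (v : Fin r → 𝓞 K) :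
    ∑ i, ι ((e.mulVec v) i) (t i) = ιM e (∑ i, ι (v i) (t i)) := by
  -- `ιM e` commutes with `ι a`
  have hcomm : ∀ a (y : T), ιM e (ι a y) = ι a (ιM e y) := fun a y => by
    rw [← hMs, ← Module.End.mul_apply, ← map_mul, ← Module.End.mul_apply, ← map_mul,
      Matrix.mul_smul, Matrix.smul_mul, mul_one, one_mul]
  rw [map_sum]
  simp_rw [hcomm, hMt, map_sum]
  rw [Finset.sum_comm]
  refine Finset.sum_congr rfl fun i _ => ?_
  rw [Matrix.mulVec, dotProduct, map_sum, LinearMap.sum_apply]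
  refine Finset.sum_congr rfl fun j _ => ?_
  rw [map_mul, Module.End.mul_apply, ← Module.End.mul_apply, ← map_mul, mul_comm, map_mul,
    Module.End.mul_apply]

/-! ## §3 The class step in rank `r`: integral matrices from `DedekindLattice` -/

/-- **The class step, rank `r`** (Steinitz splitting + `Cl(𝓞)` finite, made explicit by integral
matrices): there is a map `cls` on `𝓞`-submodules of `𝓞ʳ` with values in the finite set `Cl(𝓞)ʳ`
such that for lattices `ℓ^{j} 𝓞ʳ ⊆ M`, `ℓ^{j'} 𝓞ʳ ⊆ M'` with `cls M = cls M'` there are matrices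
`e, e' ∈ M_r(𝓞)` with `e e' = e' e = ℓ^{j+j'}` and `e M' = ℓ^{j'} M` (Shimura §7.4 Prop. 15 in
rank one: a non-zero `γ ∈ 𝔞⁻¹𝔟` is an `𝔞`-multiplication). [cite: Reiner2003MaximalOrders, §4 (Steinitz's theorem)]
[cite: Shimura1998, §7.4 Proposition 15] -/
theorem exists_classMap_matrix (r : ℕ) :
    ∃ cls : Submodule (𝓞 K) (Fin r → 𝓞 K) → (Fin r → ClassGroup (𝓞 K)),
      ∀ (M M' : Submodule (𝓞 K) (Fin r → 𝓞 K)) (j j' : ℕ),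
        (∀ v, ((ℓ : 𝓞 K) ^ j) • v ∈ M) → (∀ v, ((ℓ : 𝓞 K) ^ j') • v ∈ M') → cls M = cls M' →
        ∃ e e' : Matrix (Fin r) (Fin r) (𝓞 K),
          e * e' = ((ℓ : 𝓞 K) ^ (j + j')) • (1 : Matrix (Fin r) (Fin r) (𝓞 K)) ∧
          e' * e = ((ℓ : 𝓞 K) ^ (j + j')) • (1 : Matrix (Fin r) (Fin r) (𝓞 K)) ∧
          M'.map (Matrix.toLin' e) = ((ℓ : 𝓞 K) ^ j') • M := by
  classical
  have hℓ : ∀ j : ℕ, ((ℓ : 𝓞 K) ^ j) ≠ 0 := fun j =>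
    pow_ne_zero j (by exact_mod_cast (Fact.out : ℓ.Prime).ne_zero)
  obtain ⟨cls, hcls⟩ := DedekindLattice.exists_classMap_nonempty_linearEquiv (R := 𝓞 K) r
  refine ⟨cls, fun M M' j j' hM hM' hMM' => ?_⟩
  obtain ⟨φ⟩ := hcls M' M ⟨_, hℓ j', hM'⟩ ⟨_, hℓ j, hM⟩ hMM'.symm
  obtain ⟨e, e', hee', he'e, -, -, hmap⟩ :=
    DedekindLattice.exists_end_comp_eq_smul_of_linearEquiv φ hM hM'
  refine ⟨LinearMap.toMatrix' e, LinearMap.toMatrix' e', ?_, ?_, ?_⟩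
  · rw [← LinearMap.toMatrix'_comp, hee', LinearEquiv.map_smul, LinearMap.toMatrix'_id, pow_add]
  · rw [← LinearMap.toMatrix'_comp, he'e, LinearEquiv.map_smul, LinearMap.toMatrix'_id, pow_add]
  · rw [Matrix.toLin'_toMatrix', hmap]

/-! ## §4 The class / shape pigeonhole in rank `r` -/

/-- **The class / shape pigeonhole for lattices stable under an order of `𝓞`, rank `r`**
(Tate 1966 §2 p. 136; Shimura 1998 §7.4 Props. 15–17; Steinitz / Jordan–Zassenhaus for the
maximal order `𝓞` in `Kʳ`).  Let `T` be free of rank `r` over `ℤ_ℓ ⊗ 𝓞` (`B_{ik} = ι(b_k) t_i`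
a `ℤ_ℓ`-basis), `ιM` a matrix action (`ιM(e) t_i = Σ_j ι(e_{ji}) t_j`, `ιM(a • 1) = ι(a)`),
`N : ℕ`, and `X : ℕ → Submodule ℤ_ℓ T` lattices (`ℓ^{j} T ⊆ X i`) with `ℓᴺ ι(a)(X i) ⊆ X i`.
Then on an infinite set `S` of indices, for `m, n ∈ S` there are `e, e' ∈ M_r(𝓞)` and
`a, c, d` with `e e' = e' e = ℓᵈ` and `ℓᶜ · ιM(e)(X m) = ℓᵃ · X n`.
[cite: Tate1966Endomorphisms, §2 p. 136] [cite: Shimura1998, §7.4 Propositions 15 and 17] -/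
theorem exists_infinite_forall_exists_matrix_pow_smul_map_eq (hB : ∀ i k, B (i, k) = ι (b k) (t i))
    (ιM : Matrix (Fin r) (Fin r) (𝓞 K) →+* Module.End ℤ_[ℓ] T)
    (hMt : ∀ e i, ιM e (t i) = ∑ j, ι (e j i) (t j)) (hMs : ∀ a : 𝓞 K, ιM (a • 1) = ι a)
    (N : ℕ) (X : ℕ → Submodule ℤ_[ℓ] T)
    (htop : ∀ i, ∃ j : ℕ, (ℓ : ℤ_[ℓ]) ^ j • (⊤ : Submodule ℤ_[ℓ] T) ≤ X i)
    (hst : ∀ (i : ℕ) (a : 𝓞 K) (x : T), x ∈ X i → (ℓ : ℤ_[ℓ]) ^ N • ι a x ∈ X i) :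
    ∃ S : Set ℕ, S.Infinite ∧ ∀ m ∈ S, ∀ n ∈ S, ∃ (e e' : Matrix (Fin r) (Fin r) (𝓞 K)) (a c d : ℕ),
      e * e' = ((ℓ : 𝓞 K) ^ d) • (1 : Matrix (Fin r) (Fin r) (𝓞 K)) ∧
      e' * e = ((ℓ : 𝓞 K) ^ d) • (1 : Matrix (Fin r) (Fin r) (𝓞 K)) ∧
        (ℓ : ℤ_[ℓ]) ^ c • (X m).map (ιM e) = (ℓ : ℤ_[ℓ]) ^ a • X n := by
  classical
  haveI : Module.Free ℤ_[ℓ] T := Module.Free.of_basis B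
  have hℓ0 : (ℓ : ℤ_[ℓ]) ≠ 0 := by exact_mod_cast (Fact.out : ℓ.Prime).ne_zero
  -- `ιM (ℓ^d • 1)` acts as multiplication by `ℓ^d`
  have hMpow : ∀ (d : ℕ) (z : T), ιM (((ℓ : 𝓞 K) ^ d) • (1 : Matrix (Fin r) (Fin r) (𝓞 K))) z =
      (ℓ : ℤ_[ℓ]) ^ d • z := fun d z => by rw [hMs, apply_natCast_pow]
  -- notation: `Ψ`, the lattice of a submodule, the saturation
  set Ψ : (Fin r → 𝓞 K) → T := fun v => ∑ i, ι (v i) (t i) with hΨ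
  set L : Submodule (𝓞 K) (Fin r → 𝓞 K) → Submodule ℤ_[ℓ] T := fun M =>
    Submodule.span ℤ_[ℓ] (Ψ '' (M : Set (Fin r → 𝓞 K))) with hL
  set F : ℕ → Submodule ℤ_[ℓ] T := fun i => ⨆ a : 𝓞 K, (X i).map (ι a) with hF
  -- (F1) `X i ≤ F i`
  have hXF : ∀ i, X i ≤ F i := fun i x hx => by
    refine Submodule.mem_iSup_of_mem (1 : 𝓞 K) ?_
    exact ⟨x, hx, by rw [map_one, Module.End.one_apply]⟩
  -- (F2) `F i` is `ι`-stable
  have hFst : ∀ i (c : 𝓞 K), ∀ y ∈ F i, ι c y ∈ F i := by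
    intro i c y hy
    refine Submodule.iSup_induction (fun a : 𝓞 K => (X i).map (ι a)) (motive := fun y => ι c y ∈ F i) hy
      ?_ (by rw [map_zero]; exact Submodule.zero_mem _) (fun y z hy hz => by
        rw [map_add]; exact Submodule.add_mem _ hy hz)
    rintro a _ ⟨x, hx, rfl⟩
    refine Submodule.mem_iSup_of_mem (c * a) ⟨x, hx, ?_⟩
    rw [map_mul, Module.End.mul_apply]
  -- (F3) `ℓᴺ F i ≤ X i`
  have hNF : ∀ i, ∀ y ∈ F i, (ℓ : ℤ_[ℓ]) ^ N • y ∈ X i := by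
    intro i y hy
    refine Submodule.iSup_induction (fun a : 𝓞 K => (X i).map (ι a))
      (motive := fun y => (ℓ : ℤ_[ℓ]) ^ N • y ∈ X i) hy ?_ (by rw [smul_zero]; exact Submodule.zero_mem _)
      (fun y z hy hz => by rw [smul_add]; exact Submodule.add_mem _ hy hz)
    rintro a _ ⟨x, hx, rfl⟩
    exact hst i a x hx
  -- the `𝓞`-module of a lattice
  have hMod : ∀ i, ∃ M : Submodule (𝓞 K) (Fin r → 𝓞 K), ∀ v, v ∈ M ↔ Ψ v ∈ F i := fun i =>
    ⟨{ carrier := {v | Ψ v ∈ F i}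
       add_mem' := fun {v w} hv hw => by
         change Ψ (v + w) ∈ F i
         rw [hΨ]; simp only; rw [psi_add ι t]; exact Submodule.add_mem _ hv hw
       zero_mem' := by
         change Ψ 0 ∈ F i
         rw [hΨ]; simp only [Pi.zero_apply, map_zero, LinearMap.zero_apply,
           Finset.sum_const_zero]; exact zero_mem _
       smul_mem' := fun c v hv => by
         change Ψ (c • v) ∈ F i
         rw [hΨ]; simp only; rw [psi_smul ι t]; exact hFst i c _ hv }, fun v => Iff.rfl⟩
  choose Mo hMo using hMod
  choose j hj using htop
  -- lattice property of `Mo i`: `ℓ^{j i} • v ∈ Mo i`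
  have hlat : ∀ i (v : Fin r → 𝓞 K), ((ℓ : 𝓞 K) ^ j i) • v ∈ Mo i := fun i v => by
    rw [hMo, hΨ]
    simp only
    rw [psi_smul ι t, apply_natCast_pow]
    exact hXF i (hj i (Submodule.smul_mem_pointwise_smul _ _ _ trivial))
  -- `ℓ^{j i} T ≤ L (Mo i)` hence `F i = L (Mo i)`
  have hpowL : ∀ i (w : T), (ℓ : ℤ_[ℓ]) ^ j i • w ∈ L (Mo i) := by
    intro i w
    rw [← B.sum_repr w, Finset.smul_sum]
    refine Submodule.sum_mem _ fun p _ => ?_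
    rw [smul_comm]
    refine Submodule.smul_mem _ _ (Submodule.subset_span ⟨((ℓ : 𝓞 K) ^ j i) • Pi.single p.1 (b p.2), ?_, ?_⟩)
    · exact hlat i _
    · rw [hΨ]
      simp only
      rw [psi_smul ι t, apply_natCast_pow]
      congr 1
      rw [Finset.sum_eq_single p.1]
      · rw [Pi.single_eq_same, ← hB]
      · intro i _ hi; rw [Pi.single_eq_of_ne hi, map_zero, LinearMap.zero_apply]
      · intro h; exact (h (Finset.mem_univ _)).elim
  have hFL : ∀ i, F i = L (Mo i) := by
    intro i
    apply le_antisymm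
    · intro y hy
      obtain ⟨n, -, y', hyy'⟩ := exists_natCoords B (j i) y
      have h1 : (ℓ : ℤ_[ℓ]) ^ j i • y' ∈ F i := hXF i (hj i (Submodule.smul_mem_pointwise_smul _ _ _ trivial))
      have h2 : Ψ (fun i' => ∑ k, (n (i', k) : 𝓞 K) * b k) ∈ F i := by
        rw [hΨ]; simp only
        rw [sum_apply_sum_natCast_mul ι t b B hB]
        have : ∑ p, ((n p : ℕ) : ℤ_[ℓ]) • B p = y - (ℓ : ℤ_[ℓ]) ^ j i • y' := by
          rw [hyy', add_sub_cancel_right]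
        rw [this]
        exact Submodule.sub_mem _ hy h1
      rw [hyy']
      refine Submodule.add_mem _ ?_ (hpowL i y')
      rw [← sum_apply_sum_natCast_mul ι t b B hB]
      exact Submodule.subset_span ⟨_, (hMo i _).mpr h2, rfl⟩
    · rw [hL]
      refine Submodule.span_le.mpr ?_
      rintro _ ⟨v, hv, rfl⟩
      exact (hMo i v).mp hv
  -- transport of `L` under matrices and powers of `ℓ`
  have hLmap : ∀ (M : Submodule (𝓞 K) (Fin r → 𝓞 K)) (e : Matrix (Fin r) (Fin r) (𝓞 K)),
      L (M.map (Matrix.toLin' e)) = (L M).map (ιM e) := fun M e => by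
    rw [hL]
    simp only
    rw [Submodule.map_span, ← Set.image_comp]
    congr 1
    ext y
    constructor
    · rintro ⟨_, ⟨v, hv, rfl⟩, rfl⟩
      exact ⟨v, hv, by simp only [Function.comp_apply, Matrix.toLin'_apply, hΨ]; rw [psi_mulVec ι t ιM hMt hMs]⟩
    · rintro ⟨v, hv, rfl⟩
      exact ⟨_, ⟨v, hv, rfl⟩, by simp only [Function.comp_apply, Matrix.toLin'_apply, hΨ]; rw [psi_mulVec ι t ιM hMt hMs]⟩
  have hLpow : ∀ (M : Submodule (𝓞 K) (Fin r → 𝓞 K)) (n : ℕ),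
      L (((ℓ : 𝓞 K) ^ n) • M) = (ℓ : ℤ_[ℓ]) ^ n • L M := fun M n => by
    rw [hL]
    simp only
    rw [Submodule.smul_span, Submodule.coe_pointwise_smul, ← Set.image_smul, ← Set.image_smul,
      ← Set.image_comp, ← Set.image_comp]
    congr 1
    refine Set.image_congr fun v _ => ?_
    simp only [Function.comp_apply, hΨ]
    rw [psi_smul ι t, apply_natCast_pow]
  -- STEP 1: pigeonhole on the class data of the `𝓞`-modules `Mo i`
  obtain ⟨cls, hcls⟩ := exists_classMap_matrix (K := K) (ℓ := ℓ) r
  haveI : Fintype (ClassGroup (𝓞 K)) := inferInstance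
  obtain ⟨cl, hcl⟩ := Finite.exists_infinite_fiber fun i : ℕ => cls (Mo i)
  set S₁ : Set ℕ := (fun i : ℕ => cls (Mo i)) ⁻¹' {cl} with hS₁
  have hS₁inf : S₁.Infinite := Set.infinite_coe_iff.mp hcl
  obtain ⟨i₀, hi₀⟩ := hS₁inf.nonempty
  -- for `i ∈ S₁`: integral matrices `e_i, e'_i` with `ιM(e_i) F_i = ℓ^{j i} F_{i₀}`
  have hrel : ∀ i ∈ S₁, ∃ e e' : Matrix (Fin r) (Fin r) (𝓞 K),
      e * e' = ((ℓ : 𝓞 K) ^ (j i₀ + j i)) • (1 : Matrix (Fin r) (Fin r) (𝓞 K)) ∧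
      e' * e = ((ℓ : 𝓞 K) ^ (j i₀ + j i)) • (1 : Matrix (Fin r) (Fin r) (𝓞 K)) ∧
      (F i).map (ιM e) = (ℓ : ℤ_[ℓ]) ^ j i • F i₀ := by
    intro i hi
    have hcl' : cls (Mo i₀) = cls (Mo i) := by
      rw [show cls (Mo i₀) = cl from hi₀, show cls (Mo i) = cl from hi]
    obtain ⟨e, e', hee', he'e, hmap⟩ :=
      hcls (Mo i₀) (Mo i) (j i₀) (j i) (hlat i₀) (hlat i) hcl'
    refine ⟨e, e', hee', he'e, ?_⟩
    rw [hFL i, hFL i₀, ← hLmap, hmap, hLpow]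
  have hrel' : ∀ i, ∃ e e' : Matrix (Fin r) (Fin r) (𝓞 K), i ∈ S₁ →
      e * e' = ((ℓ : 𝓞 K) ^ (j i₀ + j i)) • (1 : Matrix (Fin r) (Fin r) (𝓞 K)) ∧
      e' * e = ((ℓ : 𝓞 K) ^ (j i₀ + j i)) • (1 : Matrix (Fin r) (Fin r) (𝓞 K)) ∧
      (F i).map (ιM e) = (ℓ : ℤ_[ℓ]) ^ j i • F i₀ := fun i => by
    by_cases hi : i ∈ S₁
    · obtain ⟨e, e', h⟩ := hrel i hi; exact ⟨e, e', fun _ => h⟩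
    · exact ⟨0, 0, fun h => (hi h).elim⟩
  choose e e' he using hrel'
  -- STEP 2: the shapes `Z i` with `ιM(e i) (X i) = ℓ^{j i} Z i`, `ℓ^{N + j i₀} T ≤ Z i`
  set M : ℕ := N + j i₀ with hM
  clear_value M
  have hshape : ∀ i ∈ S₁, ∃ Z : Submodule ℤ_[ℓ] T,
      (ℓ : ℤ_[ℓ]) ^ M • (⊤ : Submodule ℤ_[ℓ] T) ≤ Z ∧ (X i).map (ιM (e i)) = (ℓ : ℤ_[ℓ]) ^ j i • Z := by
    intro i hi
    obtain ⟨-, -, hFi⟩ := he i hi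
    have hYle : (X i).map (ιM (e i)) ≤ (ℓ : ℤ_[ℓ]) ^ j i • F i₀ :=
      hFi ▸ Submodule.map_mono (hXF i)
    have hYge : ∀ w ∈ F i₀, (ℓ : ℤ_[ℓ]) ^ j i • (ℓ : ℤ_[ℓ]) ^ N • w ∈ (X i).map (ιM (e i)) := by
      intro w hw
      have h1 : (ℓ : ℤ_[ℓ]) ^ j i • w ∈ (F i).map (ιM (e i)) :=
        hFi ▸ Submodule.smul_mem_pointwise_smul _ _ _ hw
      obtain ⟨y, hy, hyw⟩ := h1
      refine ⟨(ℓ : ℤ_[ℓ]) ^ N • y, hNF i y hy, ?_⟩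
      rw [map_smul, hyw, smul_comm]
    let Z : Submodule ℤ_[ℓ] T :=
      ((X i).map (ιM (e i))).comap (LinearMap.lsmul ℤ_[ℓ] T ((ℓ : ℤ_[ℓ]) ^ j i))
    have hZmem : ∀ z, z ∈ Z ↔ (ℓ : ℤ_[ℓ]) ^ j i • z ∈ (X i).map (ιM (e i)) := fun z => by
      simp only [Z, Submodule.mem_comap, LinearMap.lsmul_apply]
    refine ⟨Z, ?_, ?_⟩
    · intro w hw
      obtain ⟨w', -, rfl⟩ := (Submodule.mem_smul_pointwise_iff_exists _ _ _).mp hw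
      rw [hZmem, hM, pow_add, mul_smul, smul_comm ((ℓ : ℤ_[ℓ]) ^ j i)]
      rw [smul_comm]
      exact hYge _ (hXF i₀ (hj i₀ (Submodule.smul_mem_pointwise_smul _ _ _ trivial)))
    · apply le_antisymm
      · intro y hy
        obtain ⟨w, hw, hwy⟩ := (Submodule.mem_smul_pointwise_iff_exists _ _ _).mp (hYle hy)
        refine (Submodule.mem_smul_pointwise_iff_exists _ _ _).mpr ⟨w, ?_, hwy⟩
        rw [hZmem, hwy]; exact hy
      · intro y hy
        obtain ⟨z, hz, rfl⟩ := (Submodule.mem_smul_pointwise_iff_exists _ _ _).mp hy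
        exact (hZmem z).mp hz
  have hshape' : ∀ i, ∃ Z : Submodule ℤ_[ℓ] T, i ∈ S₁ →
      (ℓ : ℤ_[ℓ]) ^ M • (⊤ : Submodule ℤ_[ℓ] T) ≤ Z ∧ (X i).map (ιM (e i)) = (ℓ : ℤ_[ℓ]) ^ j i • Z :=
    fun i => by
      by_cases hi : i ∈ S₁
      · obtain ⟨Z, h⟩ := hshape i hi; exact ⟨Z, fun _ => h⟩
      · exact ⟨⊤, fun h => (hi h).elim⟩
  choose Z hZ using hshape'
  -- STEP 3: pigeonhole on shapes
  have hfin := finite_setOf_pow_smul_top_le B M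
  let shapes : Type _ := {W : Submodule ℤ_[ℓ] T // (ℓ : ℤ_[ℓ]) ^ M • (⊤ : Submodule ℤ_[ℓ] T) ≤ W}
  haveI : Finite shapes := hfin.to_subtype
  haveI : Infinite S₁ := Set.infinite_coe_iff.mpr hS₁inf
  let sh : S₁ → shapes := fun i => ⟨Z i, (hZ i i.2).1⟩
  obtain ⟨W, hW⟩ := Finite.exists_infinite_fiber sh
  set S : Set ℕ := Subtype.val '' (sh ⁻¹' {W}) with hS
  have hSinf : S.Infinite :=
    (Set.infinite_coe_iff.mp hW).image Subtype.val_injective.injOn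
  have hSmem : ∀ m ∈ S, m ∈ S₁ ∧ Z m = W.1 := by
    rintro m ⟨⟨m', hm'⟩, hm, rfl⟩
    exact ⟨hm', congrArg Subtype.val (show sh ⟨m', hm'⟩ = W from hm)⟩
  refine ⟨S, hSinf, fun m hm n hn => ?_⟩
  obtain ⟨hm₁, hZm⟩ := hSmem m hm
  obtain ⟨hn₁, hZn⟩ := hSmem n hn
  obtain ⟨hee'm, he'em, -⟩ := he m hm₁
  obtain ⟨hee'n, he'en, -⟩ := he n hn₁
  obtain ⟨-, hXm⟩ := hZ m hm₁
  obtain ⟨-, hXn⟩ := hZ n hn₁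
  -- `ℓ^{j n} ιM(e' n * e m) X m = ℓ^{j m + (j i₀ + j n)} X n`
  refine ⟨e' n * e m, e' m * e n, j m + (j i₀ + j n), j n, (j i₀ + j m) + (j i₀ + j n), ?_, ?_, ?_⟩
  · calc e' n * e m * (e' m * e n) = e' n * (e m * e' m) * e n := by
          simp only [Matrix.mul_assoc]
      _ = ((ℓ : 𝓞 K) ^ ((j i₀ + j m) + (j i₀ + j n))) • (1 : Matrix (Fin r) (Fin r) (𝓞 K)) := by
          rw [hee'm, Matrix.mul_smul, Matrix.mul_one, Matrix.smul_mul, he'en, smul_smul,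
            ← pow_add]
  · calc e' m * e n * (e' n * e m) = e' m * (e n * e' n) * e m := by
          simp only [Matrix.mul_assoc]
      _ = ((ℓ : 𝓞 K) ^ ((j i₀ + j m) + (j i₀ + j n))) • (1 : Matrix (Fin r) (Fin r) (𝓞 K)) := by
          rw [hee'n, Matrix.mul_smul, Matrix.mul_one, Matrix.smul_mul, he'em, smul_smul,
            ← pow_add, add_comm (j i₀ + j m)]
  · have hmap_mul : (X m).map (ιM (e' n * e m)) = ((X m).map (ιM (e m))).map (ιM (e' n)) := by
      rw [map_mul, ← Submodule.map_comp]; rfl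
    have hn' : ((X n).map (ιM (e n))).map (ιM (e' n)) = (ℓ : ℤ_[ℓ]) ^ (j i₀ + j n) • X n := by
      rw [← Submodule.map_comp]
      change (X n).map (ιM (e' n) * ιM (e n)) = _
      rw [← map_mul, he'en]
      ext y
      simp only [Submodule.mem_map, Submodule.mem_smul_pointwise_iff_exists]
      constructor
      · rintro ⟨z, hz, rfl⟩
        exact ⟨z, hz, (hMpow _ z).symm⟩
      · rintro ⟨z, hz, rfl⟩
        exact ⟨z, hz, hMpow _ z⟩
    rw [hmap_mul, hXm, hZm, Submodule.map_pointwise_smul, pow_add, mul_smul, ← hn', hXn, hZn,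
      Submodule.map_pointwise_smul, smul_comm]

end CMLatticeRank

end Literature.NumberTheory.ComplexMultiplication

end
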